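import Summits.QuantumAdvantage.AdviceFreeQNC0.TwistBound
import HarnessLib

/-!
# Cell qa-qnc0 / decomp-qadv (odd primes): the UNREAD twisted correlation bound, part 1/2 — weighted twisted transfer

TREE-READY PART of the node `HOME/decomp-qadv-lens-6/g9/PeelDial.lean` (decomp-qadv-lens-6 g9, §11), ZERO `def … : Prop`.

The tree's twisted transfer (`TwistedTransfer.TBV`, `twisted_pathSum_eq`, `cnsq_TBV_le`) averages each site's two
branches with the weights `(1, ζ_i)/2`.  To condition an ADAPTIVE strategy on the bits it reads (part 2) we need sites
whose bit is PINNED (weights `(1, 0)` or `(0, 1)`: deterministic shifts, non-expansive) next to twisted sites (weights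
`(1, ζ)`, contracting by `2ρ` after the tree's per-site bound).  This file sets up the weighted backward vector:

* `stepW w v s = w false · v (s+1) + w true · v (s+2)`, `TBW ω f g k` (backward vector with site weights `ω`),
  `weighted_pathSum_eq` (the weighted path sum of the `ℤ/3` walk equals `TBW`, by the tree's `wtPrefix_cons_succ`
  recursion — same induction as `TwistedTransfer.twisted_pathSum_eq`);
* norm propagation: `cnsq_stepW_of_true_zero`, `cnsq_stepW_of_false_zero` (pinned sites: `cnsq` does not grow),
  `cnsq_stepW_of_false_one` (twisted site `(1, ζ)`: `≤ (2ρ)²·cnsq` given the per-site input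
  `cnsq (twAvg ζ v) ≤ ρ²·cnsq v`), and `cnsq_TBW_le` (product bound along the walk).

No statement about strategies yet; part 2 (`CharDialUnreadTwist.lean`) does the conditioning and proves
`unread_corr_win_le`.
-/

noncomputable section

namespace Summit.QuantumAdvantage.AdviceFreeQNC0.UnreadTwist

open Finset Summit.QuantumAdvantage.AdviceFreeQNC0 TwistedTransfer ConstBells

/-! ### §11 Weighted transfer step and backward vector (generalises the tree's `TwistedTransfer.TBV`, weights `(1, ζ)/2`,
to arbitrary weight pairs — needed for sites pinned to a fixed bit) -/

/-- The weighted step `(S_w v)(s) = w(0)·v(s+1) + w(1)·v(s+2)`. -/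
def stepW (w : Bool → ℂ) (v : ZMod 3 → ℂ) : ZMod 3 → ℂ := fun s => w false * v (s + 1) + w true * v (s + 2)

/-- The weighted backward vector: `TBW 0 = f g`, `TBW (k+1) = f g · S_{ω g}(TBW_{g+1} k)`. -/
def TBW (ω : ℕ → Bool → ℂ) (f : ℕ → ZMod 3 → ℝ) : ℕ → ℕ → ZMod 3 → ℂ
  | g, 0 => fun s => (f g s : ℂ)
  | g, k + 1 => rMul (f g) (stepW (ω g) (TBW ω f (g + 1) k))

/-- CharDial sub-characteristic helper `TBW_zero` (lens-6 g8 LAND package; see the module docstring). -/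
theorem TBW_zero (ω : ℕ → Bool → ℂ) (f : ℕ → ZMod 3 → ℝ) (g : ℕ) : TBW ω f g 0 = fun s => (f g s : ℂ) := rfl

/-- CharDial sub-characteristic helper `TBW_succ` (lens-6 g8 LAND package; see the module docstring). -/
theorem TBW_succ (ω : ℕ → Bool → ℂ) (f : ℕ → ZMod 3 → ℝ) (g k : ℕ) :
    TBW ω f g (k + 1) = rMul (f g) (stepW (ω g) (TBW ω f (g + 1) k)) := rfl

/-- CharDial sub-characteristic helper `wtPrefix_zero` (lens-6 g8 LAND package; see the module docstring). -/
private theorem wtPrefix_zero₃ {m : ℕ} (u : Fin m → Bool) : wtPrefix u 0 = 0 := by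
  unfold wtPrefix
  rw [Finset.card_eq_zero, Finset.filter_eq_empty_iff]
  intro i _ h
  exact absurd h.1 (Nat.not_lt_zero _)

/-- **Weighted path sum = weighted backward vector**: with weight `ω_{g+i}(u_i)` on input bit `i`,
`Σ_u (Π_{j ≤ k} f_{g+j}(s + j + W_j(u))) · Π_{i<k} ω_{g+i}(u_i) = TBW_g k s`. -/
theorem weighted_pathSum_eq (ω : ℕ → Bool → ℂ) (f : ℕ → ZMod 3 → ℝ) (k : ℕ) : ∀ (g : ℕ) (s : ZMod 3),
    (∑ u : Fin k → Bool, ((∏ j ∈ range (k + 1), f (g + j) (s + ((j + wtPrefix u j : ℕ) : ZMod 3)) : ℝ) : ℂ) *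
        ∏ i : Fin k, ω (g + i.val) (u i)) = TBW ω f g k s := by
  induction k with
  | zero =>
    intro g s
    rw [TBW_zero]
    simp [wtPrefix_zero₃]
  | succ k ih =>
    intro g s
    rw [TBW_succ]
    rw [← Fintype.sum_equiv (Fin.consEquiv fun _ : Fin (k + 1) => Bool)
      (fun q : Bool × (Fin k → Bool) => ((∏ j ∈ range (k + 1 + 1),
        f (g + j) (s + ((j + wtPrefix (Fin.cons q.1 q.2 : Fin (k + 1) → Bool) j : ℕ) : ZMod 3)) : ℝ) : ℂ) *
        ∏ i : Fin (k + 1), ω (g + i.val) ((Fin.cons q.1 q.2 : Fin (k + 1) → Bool) i))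
      _ (fun q => rfl), Fintype.sum_prod_type]
    have hinner : ∀ b : Bool, (∑ u' : Fin k → Bool, ((∏ j ∈ range (k + 1 + 1),
        f (g + j) (s + ((j + wtPrefix (Fin.cons b u' : Fin (k + 1) → Bool) j : ℕ) : ZMod 3)) : ℝ) : ℂ) *
        ∏ i : Fin (k + 1), ω (g + i.val) ((Fin.cons b u' : Fin (k + 1) → Bool) i)) =
        (f g s : ℂ) * ω g b * TBW ω f (g + 1) k (s + 1 + ((b.toNat : ℕ) : ZMod 3)) := by
      intro b
      rw [← ih (g + 1) (s + 1 + ((b.toNat : ℕ) : ZMod 3)), Finset.mul_sum]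
      refine Finset.sum_congr rfl fun u' _ => ?_
      rw [Finset.prod_range_succ' _ (k + 1), Fin.prod_univ_succ]
      simp only [Fin.cons_zero, Fin.cons_succ, Fin.val_zero, add_zero, Fin.val_succ]
      have hfac : ∀ j ∈ range (k + 1), f (g + (j + 1)) (s + (((j + 1) +
          wtPrefix (Fin.cons b u' : Fin (k + 1) → Bool) (j + 1) : ℕ) : ZMod 3)) =
          f (g + 1 + j) (s + 1 + ((b.toNat : ℕ) : ZMod 3) + ((j + wtPrefix u' j : ℕ) : ZMod 3)) := by
        intro j _
        rw [wtPrefix_cons_succ]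
        congr 1
        · ring
        · push_cast; ring
      rw [Finset.prod_congr rfl hfac]
      simp only [wtPrefix_zero₃, Nat.cast_zero, add_zero]
      have hg : ∀ i : Fin k, g + (i.val + 1) = g + 1 + i.val := fun i => by ring
      simp only [hg]
      push_cast
      ring
    rw [Fintype.sum_bool, hinner true, hinner false]
    simp only [Bool.toNat_true, Bool.toNat_false, Nat.cast_one, Nat.cast_zero, add_zero]
    unfold rMul stepW
    rw [show s + 1 + (1 : ZMod 3) = s + 2 from by ring]
    ring

/-! ### §11b Norm propagation for weighted steps -/

/-- CharDial sub-characteristic helper `z3_add1` (lens-6 g8 LAND package; see the module docstring). -/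
private theorem z3_add1 : ((0 : ZMod 3) + 1 = 1) ∧ ((1 : ZMod 3) + 1 = 2) ∧ ((2 : ZMod 3) + 1 = 0) := by decide
/-- CharDial sub-characteristic helper `z3_add2` (lens-6 g8 LAND package; see the module docstring). -/
private theorem z3_add2 : ((0 : ZMod 3) + 2 = 2) ∧ ((1 : ZMod 3) + 2 = 0) ∧ ((2 : ZMod 3) + 2 = 1) := by decide

/-- A weight pair `(0, c)` with `‖c‖ ≤ 1` (a deterministic step by `2`) does not expand the norm. -/
theorem cnsq_stepW_of_false_zero {w : Bool → ℂ} (h0 : w false = 0) (h1 : ‖w true‖ ≤ 1) (v : ZMod 3 → ℂ) :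
    cnsq (stepW w v) ≤ cnsq v := by
  have hterm : ∀ s, ‖w false * v (s + 1) + w true * v (s + 2)‖ ^ 2 ≤ ‖v (s + 2)‖ ^ 2 := by
    intro s
    rw [h0, zero_mul, zero_add, norm_mul, mul_pow]
    have : ‖w true‖ ^ 2 ≤ 1 := by nlinarith [norm_nonneg (w true)]
    nlinarith [sq_nonneg ‖v (s + 2)‖]
  unfold cnsq stepW
  have t0 := hterm 0; have t1 := hterm 1; have t2 := hterm 2
  simp only [z3_add1.1, z3_add1.2.1, z3_add1.2.2, z3_add2.1, z3_add2.2.1, z3_add2.2.2] at t0 t1 t2 ⊢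
  linarith

/-- A weight pair `(c, 0)` with `‖c‖ ≤ 1` (a deterministic step by `1`) does not expand the norm. -/
theorem cnsq_stepW_of_true_zero {w : Bool → ℂ} (h1 : w true = 0) (h0 : ‖w false‖ ≤ 1) (v : ZMod 3 → ℂ) :
    cnsq (stepW w v) ≤ cnsq v := by
  have hterm : ∀ s, ‖w false * v (s + 1) + w true * v (s + 2)‖ ^ 2 ≤ ‖v (s + 1)‖ ^ 2 := by
    intro s
    rw [h1, zero_mul, add_zero, norm_mul, mul_pow]
    have : ‖w false‖ ^ 2 ≤ 1 := by nlinarith [norm_nonneg (w false)]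
    nlinarith [sq_nonneg ‖v (s + 1)‖]
  unfold cnsq stepW
  have t0 := hterm 0; have t1 := hterm 1; have t2 := hterm 2
  simp only [z3_add1.1, z3_add1.2.1, z3_add1.2.2, z3_add2.1, z3_add2.2.1, z3_add2.2.2] at t0 t1 t2 ⊢
  linarith

/-- A weight pair `(1, ζ)` is twice the twisted average: `‖S_{(1,ζ)} v‖² = 4·‖T_ζ v‖²`. -/
theorem cnsq_stepW_of_false_one {w : Bool → ℂ} (h0 : w false = 1) (v : ZMod 3 → ℂ) :
    cnsq (stepW w v) = 4 * cnsq (twAvg (w true) v) := by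
  unfold cnsq stepW twAvg
  rw [h0]
  simp only [one_mul, norm_div, Complex.norm_ofNat, div_pow]
  ring

/-- Along the whole walk: `‖TBW_g k‖² ≤ (Π_{i<k} B_{g+i}²) · ‖f_{g+k}‖²`. -/
theorem cnsq_TBW_le (ω : ℕ → Bool → ℂ) (f : ℕ → ZMod 3 → ℝ) (hf : ∀ g s, f g s ^ 2 ≤ 1) (B : ℕ → ℝ)
    (hB : ∀ g v, cnsq (stepW (ω g) v) ≤ B g ^ 2 * cnsq v) (k : ℕ) :
    ∀ g, cnsq (TBW ω f g k) ≤ (∏ i ∈ range k, B (g + i) ^ 2) * cnsq (TBW ω f (g + k) 0) := by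
  induction k with
  | zero => intro g; simp
  | succ k ih =>
    intro g
    have hnonneg : 0 ≤ B g ^ 2 := sq_nonneg _
    have hstep : cnsq (TBW ω f g (k + 1)) ≤ B g ^ 2 * cnsq (TBW ω f (g + 1) k) := by
      rw [TBW_succ]
      exact (cnsq_rMul_le (hf g) _).trans (hB g _)
    calc cnsq (TBW ω f g (k + 1)) ≤ B g ^ 2 * cnsq (TBW ω f (g + 1) k) := hstep
      _ ≤ B g ^ 2 * ((∏ i ∈ range k, B (g + 1 + i) ^ 2) * cnsq (TBW ω f (g + 1 + k) 0)) :=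
          mul_le_mul_of_nonneg_left (ih (g + 1)) hnonneg
      _ = (∏ i ∈ range (k + 1), B (g + i) ^ 2) * cnsq (TBW ω f (g + (k + 1)) 0) := by
          rw [Finset.prod_range_succ', add_zero, show g + 1 + k = g + (k + 1) from by ring]
          have : ∀ i ∈ range k, B (g + 1 + i) ^ 2 = B (g + (i + 1)) ^ 2 := fun i _ => by
            rw [show g + 1 + i = g + (i + 1) from by ring]
          rw [Finset.prod_congr rfl this]; ring

end Summit.QuantumAdvantage.AdviceFreeQNC0.UnreadTwist

end
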